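import Literature.MathematicalPhysics.QuantumFieldTheory.Balaban1983to89.T4CouplingAnalyticityWitness
import Summits.QuantumFields.BalabanUV.Beta.GAN24.BornLambdaLetters

/-!
# BalabanUVNodes ∕ N22 knit, WITNESSES — the hypotheses (P) (O) (R) of `BalabanUVNodesN22Knit` are jointly NON-VACUOUS with
# genuine history dependence, and the regularity clause (R) is NECESSARY: a tower with (P), (O) and a BOUNDED Lipschitz modulus whose
# moduli admit NO fading family (Track A, DAG node N22 = NE9; cluster K4 «SpineRates»; seat `pub-ymgap-dag-n22-a`)

HONEST FRAMING.  Elementary witnesses on abstract ∕ toy carriers (`T4CouplingAnalyticityWitness.natCarriers`: domain = scale, `d ≡ 0`);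
count-neutral; nothing of Bałaban's construction asserted; NE5 ∕ NE9 NOT IN PRINT, NOT PROVED; one finite four-torus programme at
fixed ε; nothing continuum ∕ ℝ⁴ ∕ OS ∕ mass-gap ∕ Clay.  0 `sorry`, 0 `def`, standard axioms.

WHY.  The knit `BalabanUVNodesN22Knit.ne9_and_fadingMemory_of_osc_smooth` concludes node N22's statement of record
`T4OutputRate.NE9 E (Window γ) κ Λ₁ ∧ FadingMemory C₉ τ Λ₁` from (P) prefix dependence, (O) oscillation fading (= tower-NE5) and (R)
coordinatewise C^{1,1} regularity.  A referee's vacuity audit asks two things, answered here in the kernel: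
* §1 `oscSmooth_nonvacuous` — (P) ∧ (O) ∧ (R) are JOINTLY INHABITED on ANY carriers by a functional with INFINITE history dependence,
  the geometric history sum `E g U X = e^{−κd(X)}·Σ_{i<scale X} θ^{scale X − i}·g_i` ((O) with `C₀ = γθ∕(1−θ)` by the birth-level geometric
  series `BornLambdaLetters.sum_pow_sub_le` BY NAME, (R) with `M = 0`), which
  moves under a change of EVERY young coupling (`θ > 0`) — so the knit's hypotheses do not secretly force coupling-independence.
* §2 `exists_osc_boundedLipschitz_not_fading` — (R) CANNOT BE DROPPED («FadingMemory from ANY modulus» is false as a bare implication):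
  on the toy carriers the tower `E g · j = θ^j·sin(g₀∕θ^j)` (`j ≥ 1`; `0` at scale `0`) has (P), (O) with `C₀ = 2`, and the LITERAL
  shape `NE9` with the BOUNDED moduli `𝟙_{i = 0}` (Lipschitz constant `1` in its one coupling at every scale, by `|sin x − sin y| ≤ |x − y|`),
  yet NO moduli family `Λ` with `NE9 E (Window γ) κ Λ ∧ FadingMemory C₉ ω Λ`, `0 ≤ ω < 1`, exists: at the histories `g₀ = θ^j·π∕2`,
  `g₀′ = θ^j·3π∕2` the term moves by `2θ^j` while `|g₀ − g₀′| = πθ^j`, so `Λ j 0 ≥ 2∕π` at every large scale `j`.  Its second derivative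
  in `g₀` is of size `θ^{−j}` — exactly the failure of (R).  (E-side twin of gaps seat ne4's `Spine/NE4/FadingNeedsRegularity`.)

References (TYPES only): [Balaban1987RG1] = T. Bałaban, Commun. Math. Phys. **109** (1987) 249–301, p. 263 (the C^∞ clause whose TYPE
(R) formalises), p. 256 (prefix dependence).
-/

noncomputable section

namespace Summit.QuantumFields.YangMills.BalabanUVNodes.N22KnitWitness

open Set Real
open scoped BigOperators
open Literature.MathematicalPhysics.QuantumFieldTheory.Balaban1983to89
open Literature.MathematicalPhysics.QuantumFieldTheory.Balaban1983to89.T4OutputRate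
open Literature.MathematicalPhysics.QuantumFieldTheory.Balaban1983to89.T4CouplingAnalyticityWitness (natCarriers)
open Summit.QuantumFields.BalabanUV.Beta.GAN24.BornLambdaLetters (sum_pow_sub_le)

/-! ## §1 Non-vacuity of (P) ∧ (O) ∧ (R) with genuine history dependence, on any carriers -/

/-- Two couplings in `]0, γ]` differ by at most `γ`. [folklore] -/
theorem abs_sub_le_of_mem_window {γ : ℝ} {g g' : ℕ → ℝ} (hg : g ∈ Window γ) (hg' : g' ∈ Window γ) (i : ℕ) :
    |g i - g' i| ≤ γ := by
  have h1 := hg i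
  have h2 := hg' i
  rw [abs_sub_le_iff]
  constructor <;> linarith [h1.1, h1.2, h2.1, h2.2]

/-- **NON-VACUITY OF THE KNIT's HYPOTHESES, WITH INFINITE HISTORY DEPENDENCE.**  On ANY output carriers `C` and background type `Bg`, for
`0 ≤ θ < 1` and `γ ≥ 0`, the geometric history functional `E g U X := e^{−κd(X)}·Σ_{i<scale X} θ^{scale X − i}·g_i` satisfies
(P) `PrefixDependenceOn E (Window γ)`, (O) oscillation fading with `C₀ = γθ∕(1−θ)` and rate `θ`, (R) coordinatewise C^{1,1} with `M = 0`
(its young-coupling sections are affine), AND it depends on EVERY young coupling when `θ > 0`: changing `g_i`, `i < scale X`, changes the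
term.  So the three hypotheses of `BalabanUVNodesN22Knit.ne9_and_fadingMemory_of_osc_smooth` are jointly inhabited by functionals with
unbounded memory. [folklore] -/
theorem oscSmooth_nonvacuous (C : Carriers) (Bg : Type) {γ κ θ : ℝ} (hγ : 0 ≤ γ) (hθ0 : 0 ≤ θ) (hθ1 : θ < 1) :
    ∃ E : Functional C Bg,
      PrefixDependenceOn E (Window γ) ∧
      (∀ g ∈ Window γ, ∀ g' ∈ Window γ, ∀ (U : Bg) (X : C.Dom) (a : ℕ), a ≤ C.scale X →
        (∀ n, a ≤ n → g n = g' n) →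
        |E g U X - E g' U X| ≤ γ * θ / (1 - θ) * θ ^ (C.scale X - a) * Real.exp (-(κ * C.d X))) ∧
      (∀ g ∈ Window γ, ∀ (U : Bg) (X : C.Dom) (i : ℕ), i < C.scale X → ∃ f' : ℝ → ℝ,
        (∀ t ∈ Icc (0 : ℝ) γ, HasDerivWithinAt (fun t : ℝ => E (Function.update g i t) U X) (f' t) (Icc (0 : ℝ) γ) t) ∧
        ∀ s ∈ Icc (0 : ℝ) γ, ∀ t ∈ Icc (0 : ℝ) γ, |f' s - f' t| ≤ 0 * Real.exp (-(κ * C.d X)) * |s - t|) ∧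
      (0 < θ → ∀ (g : ℕ → ℝ) (U : Bg) (X : C.Dom) (i : ℕ), i < C.scale X → ∀ t : ℝ, t ≠ g i →
        E (Function.update g i t) U X ≠ E g U X) := by
  set E : Functional C Bg := fun g _ X =>
    Real.exp (-(κ * C.d X)) * ∑ i ∈ Finset.range (C.scale X), θ ^ (C.scale X - i) * g i with hE
  -- the one-coupling update is affine in the new value
  have hupd : ∀ (g : ℕ → ℝ) (U : Bg) (X : C.Dom) (i : ℕ), i < C.scale X → ∀ t : ℝ,
      E (Function.update g i t) U X = E g U X + Real.exp (-(κ * C.d X)) * θ ^ (C.scale X - i) * (t - g i) := by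
    intro g U X i hi t
    simp only [hE]
    have hdiff : ∑ m ∈ Finset.range (C.scale X), θ ^ (C.scale X - m) * Function.update g i t m
        - ∑ m ∈ Finset.range (C.scale X), θ ^ (C.scale X - m) * g m = θ ^ (C.scale X - i) * (t - g i) := by
      rw [← Finset.sum_sub_distrib, Finset.sum_eq_single i]
      · rw [Function.update_self]; ring
      · intro m _ hm
        rw [Function.update_of_ne hm, sub_self]
      · intro hi'
        exact absurd (Finset.mem_range.mpr hi) hi'
    have := congrArg (fun s => Real.exp (-(κ * C.d X)) * s) hdiff
    simp only [mul_sub] at this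
    linarith
  refine ⟨E, ?_, ?_, ?_, ?_⟩
  · -- (P) prefix dependence
    intro g _ g' _ U X hagree
    simp only [hE]
    congr 1
    exact Finset.sum_congr rfl fun i hi => by rw [hagree i (Finset.mem_range.mp hi)]
  · -- (O) oscillation fading with `C₀ = γθ/(1−θ)`
    intro g hg g' hg' U X a ha hagree
    set j := C.scale X with hj
    set w := Real.exp (-(κ * C.d X)) with hw
    have hw0 : 0 < w := Real.exp_pos _
    have hsub : E g U X - E g' U X = w * ∑ i ∈ Finset.range j, θ ^ (j - i) * (g i - g' i) := by
      simp only [hE, ← hj, ← hw]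
      rw [← mul_sub, ← Finset.sum_sub_distrib]
      congr 1
      exact Finset.sum_congr rfl fun i _ => by ring
    -- the young block `i ≥ a` does not contribute; the old block is bounded by `γ·Σ_{i<a} θ^{j−i}`
    have hterm : ∀ i ∈ Finset.range j, |θ ^ (j - i) * (g i - g' i)| ≤
        if i < a then γ * (θ ^ (j - a) * θ ^ (a - i)) else 0 := by
      intro i hi
      rw [Finset.mem_range] at hi
      by_cases hia : i < a
      · rw [if_pos hia, abs_mul, abs_of_nonneg (pow_nonneg hθ0 _), ← pow_add, show j - a + (a - i) = j - i by omega]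
        calc θ ^ (j - i) * |g i - g' i| ≤ θ ^ (j - i) * γ :=
              mul_le_mul_of_nonneg_left (abs_sub_le_of_mem_window hg hg' i) (pow_nonneg hθ0 _)
          _ = γ * θ ^ (j - i) := mul_comm _ _
      · rw [if_neg hia, hagree i (not_lt.mp hia), sub_self, mul_zero, abs_zero]
    have hsum : |∑ i ∈ Finset.range j, θ ^ (j - i) * (g i - g' i)| ≤ γ * θ ^ (j - a) * (θ / (1 - θ)) := by
      calc |∑ i ∈ Finset.range j, θ ^ (j - i) * (g i - g' i)|
          ≤ ∑ i ∈ Finset.range j, |θ ^ (j - i) * (g i - g' i)| := Finset.abs_sum_le_sum_abs _ _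
        _ ≤ ∑ i ∈ Finset.range j, (if i < a then γ * (θ ^ (j - a) * θ ^ (a - i)) else 0) := Finset.sum_le_sum hterm
        _ = ∑ i ∈ Finset.range a, γ * (θ ^ (j - a) * θ ^ (a - i)) := by
            rw [Finset.sum_ite, Finset.sum_const_zero, add_zero]
            congr 1
            ext i
            simp only [Finset.mem_filter, Finset.mem_range]
            omega
        _ = γ * θ ^ (j - a) * ∑ i ∈ Finset.range a, θ ^ (a - i) := by
            rw [Finset.mul_sum]
            exact Finset.sum_congr rfl fun i _ => by ring
        _ ≤ γ * θ ^ (j - a) * (θ / (1 - θ)) :=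
            mul_le_mul_of_nonneg_left (sum_pow_sub_le hθ0 hθ1 a) (mul_nonneg hγ (pow_nonneg hθ0 _))
    rw [hsub, abs_mul, abs_of_pos hw0]
    calc w * |∑ i ∈ Finset.range j, θ ^ (j - i) * (g i - g' i)| ≤ w * (γ * θ ^ (j - a) * (θ / (1 - θ))) :=
          mul_le_mul_of_nonneg_left hsum hw0.le
      _ = γ * θ / (1 - θ) * θ ^ (j - a) * w := by ring
  · -- (R) the sections are affine: derivative `w·θ^{j−i}`, Lipschitz constant of the derivative `0`
    intro g _ U X i hi
    refine ⟨fun _ => Real.exp (-(κ * C.d X)) * θ ^ (C.scale X - i), fun t _ => ?_, fun s _ t _ => by simp⟩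
    have hfun : (fun t : ℝ => E (Function.update g i t) U X)
        = fun t : ℝ => E g U X + Real.exp (-(κ * C.d X)) * θ ^ (C.scale X - i) * (t - g i) :=
      funext fun t => hupd g U X i hi t
    rw [hfun]
    have hd : HasDerivAt (fun t : ℝ => E g U X + Real.exp (-(κ * C.d X)) * θ ^ (C.scale X - i) * (t - g i))
        (Real.exp (-(κ * C.d X)) * θ ^ (C.scale X - i)) t := by
      have h1 := ((hasDerivAt_id t).sub_const (g i)).const_mul (Real.exp (-(κ * C.d X)) * θ ^ (C.scale X - i))
      rw [mul_one] at h1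
      exact h1.const_add (E g U X)
    exact hd.hasDerivWithinAt
  · -- genuine dependence on every young coupling
    intro hθ g U X i hi t ht
    rw [hupd g U X i hi t]
    have hw0 : 0 < Real.exp (-(κ * C.d X)) := Real.exp_pos _
    have hne : Real.exp (-(κ * C.d X)) * θ ^ (C.scale X - i) * (t - g i) ≠ 0 :=
      mul_ne_zero (mul_ne_zero hw0.ne' (pow_ne_zero _ hθ.ne')) (sub_ne_zero.mpr ht)
    intro h
    exact hne (by linarith)

/-! ## §2 The regularity clause (R) is necessary: bounded Lipschitz moduli + (O) admit NO fading family -/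

/-- **(R) CANNOT BE DROPPED.**  On the toy carriers `natCarriers` (domain = scale index `j`, `d ≡ 0`), for `0 < θ < 1` and `γ > 0`, the tower
`E g · j = θ^j·sin(g₀∕θ^j)` for `j ≥ 1` (`0` at scale `0`) has (P) prefix dependence, (O) oscillation fading with `C₀ = 2`, and NE9's LITERAL
Lipschitz shape `NE9 E (Window γ) κ Λ₀` with the BOUNDED moduli `Λ₀ j i = 𝟙_{i = 0}` — but there is NO family `Λ` with
`NE9 E (Window γ) κ Λ ∧ FadingMemory C₉ ω Λ`, `0 ≤ ω < 1`: the moduli in the coupling `g₀` are `≥ 2∕π` at every large scale.  So «fading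
moduli from ANY Lipschitz modulus + the tower rate» is false; the knit's clause (R) (here violated: `|∂²E∕∂g₀²| ∼ θ^{−j}`) is what makes it
true. [folklore] -/
theorem exists_osc_boundedLipschitz_not_fading {γ κ θ : ℝ} (hγ : 0 < γ) (hθ0 : 0 < θ) (hθ1 : θ < 1) :
    ∃ E : Functional natCarriers Unit,
      PrefixDependenceOn E (Window γ) ∧
      (∀ g ∈ Window γ, ∀ g' ∈ Window γ, ∀ (U : Unit) (X : ℕ) (a : ℕ), a ≤ natCarriers.scale X →
        (∀ n, a ≤ n → g n = g' n) →
        |E g U X - E g' U X| ≤ 2 * θ ^ (natCarriers.scale X - a) * Real.exp (-(κ * natCarriers.d X))) ∧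
      NE9 E (Window γ) κ (fun _ i => if i = 0 then 1 else 0) ∧
      ¬ ∃ (Λ : ℕ → ℕ → ℝ) (C₉ ω : ℝ), 0 ≤ ω ∧ ω < 1 ∧ NE9 E (Window γ) κ Λ ∧ FadingMemory C₉ ω Λ := by
  set E : Functional natCarriers Unit :=
    fun g _ (j : ℕ) => if j = 0 then 0 else θ ^ j * Real.sin (g 0 / θ ^ j) with hE
  have hd0 : ∀ X : ℕ, Real.exp (-(κ * natCarriers.d X)) = 1 := fun X => by
    simp [natCarriers]
  have hscale : ∀ X : ℕ, natCarriers.scale X = X := fun X => rfl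
  -- Lipschitz in the one coupling with constant 1, at every scale
  have hLip : ∀ (g g' : ℕ → ℝ) (U : Unit) (j : ℕ), |E g U j - E g' U j| ≤ |g 0 - g' 0| := by
    intro g g' U j
    simp only [hE]
    by_cases hj : j = 0
    · simp [hj]
    · rw [if_neg hj, if_neg hj, ← mul_sub, abs_mul, abs_of_pos (pow_pos hθ0 j)]
      have hθj : 0 < θ ^ j := pow_pos hθ0 j
      calc θ ^ j * |Real.sin (g 0 / θ ^ j) - Real.sin (g' 0 / θ ^ j)| ≤ θ ^ j * |g 0 / θ ^ j - g' 0 / θ ^ j| :=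
            mul_le_mul_of_nonneg_left (Real.abs_sin_sub_sin_le _ _) hθj.le
        _ = |g 0 - g' 0| := by
            rw [← sub_div, abs_div, abs_of_pos hθj, mul_div_cancel₀ _ hθj.ne']
  refine ⟨E, ?_, ?_, ?_, ?_⟩
  · -- (P): the term at scale `X ≥ 1` depends on `g 0` only, at scale `0` on nothing
    intro g _ g' _ U X hagree
    change ℕ at X
    simp only [hE]
    by_cases hX : X = 0
    · simp [hX]
    · have h0 : g 0 = g' 0 := hagree 0 (by rw [hscale]; omega)
      rw [h0]
  · -- (O) with `C₀ = 2`: either the histories coincide (`a = 0`) or the term is anyway `≤ θ^X ≤ θ^{X−a}` in size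
    intro g hg g' hg' U X a ha hagree
    rw [hd0, mul_one]
    change a ≤ X at ha
    show |E g U X - E g' U X| ≤ 2 * θ ^ (X - a)
    rcases Nat.eq_zero_or_pos a with rfl | ha0
    · have hgg : g = g' := funext fun n => hagree n (Nat.zero_le n)
      rw [hgg, sub_self, abs_zero]
      positivity
    · have hX : X ≠ 0 := by omega
      have hb : ∀ h : ℕ → ℝ, |E h U X| ≤ θ ^ X := fun h => by
        simp only [hE, if_neg hX]
        rw [abs_mul, abs_of_pos (pow_pos hθ0 X)]
        exact mul_le_of_le_one_right (pow_pos hθ0 X).le (Real.abs_sin_le_one _)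
      have hmono : θ ^ X ≤ θ ^ (X - a) := pow_le_pow_of_le_one hθ0.le hθ1.le (Nat.sub_le X a)
      calc |E g U X - E g' U X| ≤ |E g U X| + |E g' U X| := abs_sub _ _
        _ ≤ θ ^ X + θ ^ X := add_le_add (hb g) (hb g')
        _ ≤ 2 * θ ^ (X - a) := by linarith
  · -- NE9's literal shape with the BOUNDED moduli `𝟙_{i = 0}`
    intro g _ g' _ U X
    change ℕ at X
    rw [hd0, one_mul]
    by_cases hX : X = 0
    · subst hX
      simp [hE, hscale]
    · have hsum : ∑ i ∈ Finset.range (natCarriers.scale X), (if i = 0 then (1 : ℝ) else 0) * |g i - g' i|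
          = |g 0 - g' 0| := by
        rw [hscale, Finset.sum_eq_single 0]
        · simp
        · intro i _ hi
          simp [hi]
        · intro h
          exact absurd (Finset.mem_range.mpr (Nat.pos_of_ne_zero hX)) h
      rw [hsum]
      exact hLip g g' U X
  · -- NO fading family: test the scale-`j` term at `g₀ = θ^j·π/2` against `g₀' = θ^j·(π/2 + π)`
    rintro ⟨Λ, C₉, ω, hω0, hω1, hN, hF⟩
    have hC9 : 0 ≤ C₉ := by
      have h := hF 0 0 le_rfl
      simpa using h.1.trans h.2
    -- a scale beyond which `C₉·π·ω^j < 2` and `θ^j·(π/2 + π) ≤ γ`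
    obtain ⟨n₁, hn₁⟩ : ∃ n : ℕ, ω ^ n < 2 / ((C₉ + 1) * π) :=
      exists_pow_lt_of_lt_one (by positivity) hω1
    obtain ⟨n₂, hn₂⟩ : ∃ n : ℕ, θ ^ n < γ / (π / 2 + π) :=
      exists_pow_lt_of_lt_one (by positivity) hθ1
    set j : ℕ := max (max n₁ n₂) 1 with hj
    have hj1 : 1 ≤ j := le_max_right _ _
    have hjn₁ : n₁ ≤ j := (le_max_left _ _).trans (le_max_left _ _)
    have hjn₂ : n₂ ≤ j := (le_max_right _ _).trans (le_max_left _ _)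
    have hθj : 0 < θ ^ j := pow_pos hθ0 j
    have hωj : ω ^ j < 2 / ((C₉ + 1) * π) := (pow_le_pow_of_le_one hω0 hω1.le hjn₁).trans_lt hn₁
    have hθjγ : θ ^ j * (π / 2 + π) ≤ γ := by
      have h := (pow_le_pow_of_le_one hθ0.le hθ1.le hjn₂).trans hn₂.le
      have hπ : 0 < π / 2 + π := by positivity
      rwa [le_div_iff₀ hπ] at h
    -- the two test histories (all other couplings `= γ`)
    set g : ℕ → ℝ := fun n => if n = 0 then θ ^ j * (π / 2) else γ with hg
    set g' : ℕ → ℝ := fun n => if n = 0 then θ ^ j * (π / 2 + π) else γ with hg'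
    have hgW : g ∈ Window γ := by
      intro n
      by_cases hn : n = 0
      · simp only [hg, hn, if_true]
        exact ⟨by positivity, by nlinarith [Real.pi_pos]⟩
      · simp only [hg, hn, if_false]
        exact ⟨hγ, le_rfl⟩
    have hg'W : g' ∈ Window γ := by
      intro n
      by_cases hn : n = 0
      · simp only [hg', hn, if_true]
        exact ⟨by positivity, hθjγ⟩
      · simp only [hg', hn, if_false]
        exact ⟨hγ, le_rfl⟩
    have hj0 : j ≠ 0 := by omega
    -- the term moves by `2θ^j`
    have hLHS : |E g () j - E g' () j| = 2 * θ ^ j := by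
      simp only [hE, if_neg hj0, hg, hg', if_true]
      rw [mul_div_cancel_left₀ _ hθj.ne', mul_div_cancel_left₀ _ hθj.ne', Real.sin_add_pi, Real.sin_pi_div_two]
      rw [show θ ^ j * 1 - θ ^ j * -1 = 2 * θ ^ j by ring, abs_of_pos (by positivity)]
    -- the history bracket is `Λ j 0 · πθ^j`
    have hRHS : ∑ i ∈ Finset.range (natCarriers.scale j), Λ (natCarriers.scale j) i * |g i - g' i|
        = Λ j 0 * (θ ^ j * π) := by
      rw [hscale, Finset.sum_eq_single 0]
      · simp only [hg, hg', if_true]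
        rw [show θ ^ j * (π / 2) - θ ^ j * (π / 2 + π) = -(θ ^ j * π) by ring, abs_neg, abs_of_pos (by positivity)]
      · intro i _ hi
        simp [hg, hg', hi]
      · intro h
        exact absurd (Finset.mem_range.mpr (Nat.pos_of_ne_zero hj0)) h
    have key := hN g hgW g' hg'W () j
    rw [hLHS, hd0, one_mul, hRHS] at key
    -- `Λ j 0 ≤ C₉ ω^j`
    have hΛ : Λ j 0 ≤ C₉ * ω ^ j := by simpa using (hF j 0 (Nat.zero_le j)).2
    have h2 : 2 * θ ^ j ≤ C₉ * ω ^ j * (θ ^ j * π) :=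
      key.trans (mul_le_mul_of_nonneg_right hΛ (by positivity))
    -- divide by `θ^j π > 0`: `2 ≤ C₉ π ω^j < 2(C₉/(C₉+1)) < 2`
    have h3 : 2 ≤ C₉ * π * ω ^ j := by
      have : 2 * θ ^ j ≤ (C₉ * π * ω ^ j) * θ ^ j := by linarith [h2]
      exact le_of_mul_le_mul_right this hθj
    have h4 : C₉ * π * ω ^ j < 2 := by
      have hπ : 0 < (C₉ + 1) * π := by positivity
      calc C₉ * π * ω ^ j ≤ (C₉ + 1) * π * ω ^ j :=
            mul_le_mul_of_nonneg_right (by nlinarith [Real.pi_pos]) (pow_nonneg hω0 j)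
        _ < (C₉ + 1) * π * (2 / ((C₉ + 1) * π)) := mul_lt_mul_of_pos_left hωj hπ
        _ = 2 := by field_simp
    linarith

end Summit.QuantumFields.YangMills.BalabanUVNodes.N22KnitWitness

end
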